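/-
Copyright (c) 2026 the pub-hodgecm-mathlib formalisation cell (harness21).  Prover seat hodgecm-mathlib-K2E1-p16 (g3), Track B «K2-LIT» ENGINE E1, h413 = `stmt-HodgeConjecture-24833`,
route `HCCMUnconditional`, R90-S8 «ContSpec-n½», hCONT ROAD D, deal S8-R171 (1) (S8 dealer R90-CS-plan (g3)): (D2) — THE TRUNCATION OF THE CONTINUED χ-EISENSTEIN FAMILY OF `U(J₃)`
IS BOUNDED ON `G(𝔸)`, LOCALLY UNIFORMLY IN THE SPECTRAL PARAMETER, hence square integrable on the automorphic quotient — HYPOTHESIS-FIRST on (D1) (the cusp bound of `Ẽ(z) − Ẽ(z)_B`).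
-/
import Summits.HodgeConjecture.HodgeConjecture.Theorems.K2E1TruncatedEisensteinBoundedCMThree   -- ★ p857707 `exists_isCompact_siegel_low_three`, `measurable_truncation_three`; brings ★ R6e (`norm_truncation_le_of_rational_invariant_three`, `memLp_quotFun_of_bound`, `measurable_quotFun_of_measurable`), ★ `exists_siegel_cover_three`, ★ Iwasawa (CM), ★ `truncation_rational_mul`
import HarnessLib

/-!
# h413 ∕ R90-S8 hCONT ROAD D, (D2) — `K2E1ChiContinuedTruncationBoundedCMThree`: `Λ^T Ẽ_χ(z)` IS BOUNDED ON `U(2,1)(𝔸_{L⁺})` LOCALLY UNIFORMLY IN `z` (off the poles), HENCE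
# `Λ^T Ẽ_χ(z) ∈ L²(X, μ)` WITH A LOCALLY UNIFORM MAJORANT — modulo (D1), the locally uniform cusp bound of `Ẽ(z) − Ẽ(z)_B`

Cell `pub/hodgecm-mathlib`, crux H413 = `stmt-HodgeConjecture-24833`; S8 dealer R90-CS-plan (g3) S8-R171 (1); census on the R90 bus 2026-09-05T00:41Z; road memo K2E1-p10 (g5)
`K2/K2E1-p10/g5/CENSUS-hCONT.K2E1-p10-g5.md` (bde697eb42d2798a), ROAD D = (D1) cusp bound → (D2) THIS FILE → (D4) assembly (★ `Literature.Analysis.Complex.analyticOnNhd_of_locally_bounded`).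
THEOREMS ONLY (no `def`, no `instance`, no notation, no named-fact hypothesis, no `sorry`; default heartbeats); lane `--supports stmt-HodgeConjecture-24833 --as helper` (count-neutral).

THE MATHEMATICS ([MoeglinWaldspurger1995, I.2.13, IV.2]; [Arthur1980TraceFormulaII, §1, Lemma 1.4]; [BernsteinLapid2019, §4]).  For `T ≥ 1` and a left-`G(F)`-invariant `u` on
`U(J₃)(𝔸_F)`, above the floor only the Siegel top contributes to Arthur's truncation: `Λ^T u(y) = u(y) − 𝟙[T < H(γ₀y)]·u_B(γ₀y)` at the maximiser `γ₀` (★ `truncation_apply_of_isMax` ∕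
★ R6e `norm_truncation_le_of_rational_invariant_three`).  Hence `‖Λ^T u‖ ≤ max M₀ M₁` as soon as (body) `‖u‖ ≤ M₀` on the LOW PART `𝔖 ∩ {H ≤ T}` of a Siegel set `𝔖` with
`G(F)·𝔖 = G(𝔸)` — which lies in ONE COMPACT `C` depending only on `T` (★ `exists_siegel_cover_three`, ★ `exists_isCompact_siegel_low_three`) — and (top) `‖u − u_B‖ ≤ M₁` on `{H > T}`.
For the CONTINUED χ-Eisenstein family `z ↦ Ẽ(z) = Ec z` below `Re z = 2` the series domination of ★ `K2E1ChiTruncatedEisensteinBoundedCMThree` is gone, but the two inputs survive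
LOCALLY UNIFORMLY IN `z`: (body) the joint local bound (E2-bd) `hEbd` of the ★ exports (`∀ z₁ ∉ P, ∀ K compact, ∃ V ∈ 𝓝 z₁, ∃ M, ∀ z ∈ V, ∀ g ∈ K, ‖Ec z g‖ ≤ M`, ★ p863590) read
on the compact `C`; (top) the cusp bound (D1) `hD1 : ∀ z₁ ∈ D, ∃ V ∈ 𝓝 z₁, ∃ M, ∀ z ∈ V, ∀ g, cstar < H g → ‖Ec z g − (Ec z)_B g‖ ≤ M` (K2E1-p10's `K2E1ChiContinuedCuspBoundCMThree`,
a VISIBLE LETTER here), provided `T ≥ max 1 cstar`.  No joint continuity in `(z, g)` is needed (★ R6g `exists_norm_truncation_le_family_three` asks for it; this file is its re-cut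
«of bound»).  Consequences: `Λ^T(Ec z)` is Borel (separate continuity (E4) `hE4`, ★ `measurable_truncation_three`), descends to a Borel function on `X = G(F)∖G(𝔸)` (★
`measurable_quotFun_of_measurable`, invariance ★ `truncation_rational_mul` ∘ `hEcinv`), lies in every `L^p(X, μ)`, `μ` finite (★ R6e `memLp_quotFun_of_bound`), and the family
`s ↦ quotFun (Λ^T(Ec s))` satisfies the hypotheses `hloc` ∕ `hmeas` of ★ `analyticOnNhd_of_locally_bounded` TOKEN FOR TOKEN — the (D4) assembly's inputs.
* §1 (generic quadratic `(F, E, c)`, `[E:F] = 2`, `c² = 1 ≠ c`, Iwasawa) **`exists_isCompact_forall_norm_truncation_le_three`** — ONE compact `C` (depending on `T` only) such that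
  `‖u‖ ≤ M₀` on `C` and `‖u − u_B‖ ≤ M₁` on `{H > T}` give `‖Λ^T u‖ ≤ max M₀ M₁`, for EVERY left-`G(F)`-invariant `u`.
* §2 (generic) **`exists_nhds_forall_norm_truncation_le_of_letters_three`** — for a family `Ec` with `hEcinv`, `hEbd` on an OPEN `D` and the cusp letter at threshold `T` locally
  uniformly on `D`: `∀ z₀ ∈ D, ∃ V ∈ 𝓝 z₀, V ⊆ D ∧ ∃ M, ∀ z ∈ V, ∀ g, ‖Λ^T(Ec z) g‖ ≤ M`; **`measurable_quotFun_truncation_of_continuous_three`** — the Borel descent of one slice.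
* §3 (the CM pair `L ∕ L⁺`, `N = 3`; letters `hE4 hEbd hEcinv` in the ★ (V)-assembly's bytes over a domain `D`, `hD1` in (D1)'s bytes, `1 ≤ T`, `cstar ≤ T`)
  **`exists_nhds_norm_truncation_continued_le_cm_three`** (THE BOUND), **`measurable_quotFun_truncation_continued_cm_three`**, **`memLp_quotFun_truncation_continued_cm_three`**
  (every `p`, every finite `μ` — (D4)'s `Fam z := (memLp …).toLp`), **`hloc_truncation_continued_cm_three`** ∕ **`hmeas_truncation_continued_cm_three`** (★
  `analyticOnNhd_of_locally_bounded`'s `hloc` ∕ `hmeas` with `f s := quotFun (Λ^T_{ν,𝓕}(Ec s))`, `U := D`).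
* §4 (THE hCONT ∕ (V) FRAME, `D := {1<Re} ∖ Sp`, `IsOpen` discharged — `isOpen_slitPlane`) the same four heads with the letters in the ★ (V)-assembly's ∕ (D1)'s bytes VERBATIM:
  **`exists_nhds_norm_truncation_continued_le_slit_cm_three`**, **`memLp_quotFun_truncation_continued_slit_cm_three`**, **`hloc_truncation_continued_slit_cm_three`**,
  **`hmeas_truncation_continued_slit_cm_three`** — the (D4) assembly feeds ★ `analyticOnNhd_of_locally_bounded (isOpen_slitPlane Sp) hdiff (hmeas_…) (hloc_…) hF` by name.
HONEST LABEL: HC_CM is proved only modulo the 7 printed citations (2 remaining named inputs: hLiu418 = `stmt-HodgeConjecture-24832`, h413 = `stmt-HodgeConjecture-24833`) until rung 0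
closes; this file asserts no named fact and closes no socket; its CM heads are CONDITIONAL on the visible letters `hE4 hEbd hEcinv` (★ exports ∕ ★ p863205) and `hD1` ((D1), not in
this file); count-neutral.

## References
* [MoeglinWaldspurger1995] C. Mœglin, J.-L. Waldspurger, *Spectral Decomposition and Eisenstein Series* (1995), I.2.1–I.2.2, I.2.13, IV.2.
* [Arthur1980TraceFormulaII] J. Arthur, *A trace formula for reductive groups II*, Compositio Math. 40 (1980), §1 (Lemma 1.4), §4.
* [BernsteinLapid2019] J. Bernstein, E. Lapid, *On the meromorphic continuation of Eisenstein series*, J. Amer. Math. Soc. 37 (2024), §4.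
* [Garrett2018] P. Garrett, *Modern Analysis of Automorphic Forms by Example* (2018), §2.10–§2.11.
-/

set_option autoImplicit false
-- the mandated namespace repeats the single-problem summit's segment (`HodgeConjecture.HodgeConjecture`)
set_option linter.dupNamespace false

noncomputable section

open MeasureTheory Measure NumberField IsDedekindDomain Set Filter Topology MulAction
open scoped ENNReal NNReal Pointwise
open Literature.NumberTheory.Automorphic Literature.NumberTheory.Automorphic.UnitaryGroup AdelicGroupData
open Summit.HodgeConjecture.HodgeConjecture.Cruxes.H413.K2E1BorelEisensteinU
open Summit.HodgeConjecture.HodgeConjecture.Cruxes.H413.K2E1TruncatedEisensteinL2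
open Summit.HodgeConjecture.HodgeConjecture.Cruxes.H413.K2E1ReductionTheoryU3
open Summit.HodgeConjecture.HodgeConjecture.Cruxes.H413.K2E1TruncatedEisensteinBoundedCMThree

namespace Summit.HodgeConjecture.HodgeConjecture.Cruxes.H413.K2E1ChiContinuedTruncationBoundedCMThree

/-! ## §1 Generic quadratic `(F, E, c)`: ONE compact controls the truncation of every left-`G(F)`-invariant function -/

section Generic

variable {F E : Type} [Field F] [NumberField F] [Field E] [NumberField E] [Algebra F E] {c : E ≃ₐ[F] E}
variable [MeasurableSpace (adelicUnipotent F E c 3)] [BorelSpace (adelicUnipotent F E c 3)]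

/-- **ONE COMPACT CONTROLS `Λ^T` OF EVERY AUTOMORPHIC FUNCTION** (`U(J₃)`, `[E:F] = 2`, `c² = 1 ≠ c`, Iwasawa `hIw`; `T ≥ 1`): there is a compact `C ⊆ G(𝔸_F)` such that for every
left-`G(F)`-invariant `u` and all `M₀ M₁`, `‖u‖ ≤ M₀` on `C` and `‖u − u_B‖ ≤ M₁` on `{H > T}` imply `‖Λ^T u(g)‖ ≤ max M₀ M₁` for all `g`.  `C` ⊇ the low part `𝔖 ∩ {H ≤ T}` of a
Siegel set with `G(F)·𝔖 = G(𝔸)` (★ `exists_siegel_cover_three`, ★ `exists_isCompact_siegel_low_three`); then ★ R6e `norm_truncation_le_of_rational_invariant_three` (Siegel top at the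
maximiser, body on `𝔖`).  No continuity of `u` is used. [cite: MoeglinWaldspurger1995, I.2.13] [cite: Arthur1980TraceFormulaII, §1 (Lemma 1.4)] [cite: Garrett2018, §2.10–§2.11] -/
theorem exists_isCompact_forall_norm_truncation_le_three (h2 : Module.finrank F E = 2) (hc : c * c = 1) (hc1 : c ≠ 1)
    (hIw : ∀ g : (quasiSplit F E c 3).Adelic, ∃ b ∈ borelAdelic F E c 3, ∃ k : (quasiSplit F E c 3).Adelic,
      adelicVal F E c 3 ((StdForm.antidiagonal 3).over E) k ∈ standardMaximalCompactGL 3 E ∧ g = b * k)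
    (ν : Measure (adelicUnipotent F E c 3)) [ν.IsHaarMeasure] {𝓕 : Set (adelicUnipotent F E c 3)}
    (h𝓕 : IsFundamentalDomain (rationalUnipotent F E c 3) 𝓕 ν) {T : ℝ≥0} (hT : 1 ≤ T) :
    ∃ C : Set (quasiSplit F E c 3).Adelic, IsCompact C ∧
      ∀ {u : (quasiSplit F E c 3).Adelic → ℂ},
        (∀ (γ : (quasiSplit F E c 3).arithmeticSubgroup) (x : (quasiSplit F E c 3).Adelic), u ((γ : (quasiSplit F E c 3).Adelic) * x) = u x) →
        ∀ {M₀ M₁ : ℝ}, (∀ g ∈ C, ‖u g‖ ≤ M₀) →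
          (∀ g : (quasiSplit F E c 3).Adelic, T < borelHeight g → ‖u g - borelConstantTerm ν 𝓕 u g‖ ≤ M₁) →
            ∀ g : (quasiSplit F E c 3).Adelic, ‖truncation ν 𝓕 T u g‖ ≤ max M₀ M₁ := by
  haveI := t2Space_adeleRing_of_numberField E
  haveI : T2Space (quasiSplit F E c 3).Adelic := inferInstanceAs (T2Space (adelic F E c 3 ((StdForm.antidiagonal 3).over E)))
  obtain ⟨Ω, K, t, ht, hΩ, hΩc, hKc, hcov⟩ := exists_siegel_cover_three h2 hc1 hc hIw
  obtain ⟨C, hC, hsub⟩ := exists_isCompact_siegel_low_three hIw ht hΩ (by rw [hΩc.isClosed.closure_eq]; exact hΩc) hKc T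
  exact ⟨C, hC, fun hu _ _ hlow hdec g => norm_truncation_le_of_rational_invariant_three ν h𝓕 hT hu hcov (fun s hs hsT => hlow s (hsub s hs hsT)) hdec g⟩

/-- **`Λ^T Φ_z` IS BOUNDED UNIFORMLY ON A PARAMETER SET `Z`, «OF BOUND»** — the re-cut of ★ R6g `exists_norm_truncation_le_family_three` with JOINT CONTINUITY REPLACED BY A BOUND ON
COMPACTS: if each `Φ_z` (`z ∈ Z`) is left-`G(F)`-invariant, `Φ` is bounded on `Z × C` for every compact `C` (`hbd`), and `‖Φ_z − (Φ_z)_B‖ ≤ M₁` on `{H > T}` for `z ∈ Z`, then ONE `M`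
bounds `‖Λ^T Φ_z(g)‖` for all `z ∈ Z`, all `g`. [cite: MoeglinWaldspurger1995, I.2.13 and IV.2] [cite: Arthur1980TraceFormulaII, §1 (Lemma 1.4)] -/
theorem exists_forall_norm_truncation_le_family_of_bound_three (h2 : Module.finrank F E = 2) (hc : c * c = 1) (hc1 : c ≠ 1)
    (hIw : ∀ g : (quasiSplit F E c 3).Adelic, ∃ b ∈ borelAdelic F E c 3, ∃ k : (quasiSplit F E c 3).Adelic,
      adelicVal F E c 3 ((StdForm.antidiagonal 3).over E) k ∈ standardMaximalCompactGL 3 E ∧ g = b * k)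
    (ν : Measure (adelicUnipotent F E c 3)) [ν.IsHaarMeasure] {𝓕 : Set (adelicUnipotent F E c 3)}
    (h𝓕 : IsFundamentalDomain (rationalUnipotent F E c 3) 𝓕 ν) {T : ℝ≥0} (hT : 1 ≤ T)
    {ι : Type*} {Z : Set ι} {Φ : ι → (quasiSplit F E c 3).Adelic → ℂ}
    (hΦ : ∀ z ∈ Z, ∀ (γ : (quasiSplit F E c 3).arithmeticSubgroup) (x : (quasiSplit F E c 3).Adelic), Φ z ((γ : (quasiSplit F E c 3).Adelic) * x) = Φ z x)
    (hbd : ∀ C : Set (quasiSplit F E c 3).Adelic, IsCompact C → ∃ M₀ : ℝ, ∀ z ∈ Z, ∀ g ∈ C, ‖Φ z g‖ ≤ M₀)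
    {M₁ : ℝ} (hdec : ∀ z ∈ Z, ∀ g : (quasiSplit F E c 3).Adelic, T < borelHeight g → ‖Φ z g - borelConstantTerm ν 𝓕 (Φ z) g‖ ≤ M₁) :
    ∃ M : ℝ, ∀ z ∈ Z, ∀ g : (quasiSplit F E c 3).Adelic, ‖truncation ν 𝓕 T (Φ z) g‖ ≤ M := by
  obtain ⟨C, hC, hctl⟩ := exists_isCompact_forall_norm_truncation_le_three h2 hc hc1 hIw ν h𝓕 hT
  obtain ⟨M₀, hM₀⟩ := hbd C hC
  exact ⟨max M₀ M₁, fun z hz g => hctl (hΦ z hz) (fun g hg => hM₀ z hz g hg) (hdec z hz) g⟩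

/-! ## §2 Generic: the neighbourhood form for a continued family, from the local letters `hEcinv`, `hEbd` and the cusp letter -/

/-- **`Λ^T(Ec z)` IS BOUNDED ON `G(𝔸)` LOCALLY UNIFORMLY IN `z ∈ D`, OF LETTERS** (`U(J₃)`, `[E:F] = 2`, `c² = 1 ≠ c`, Iwasawa; `T ≥ 1`; `D` OPEN): if on `D` the slices `Ec z` are
left-`G(F)`-invariant (`hEcinv`), jointly locally bounded (`hEbd : ∀ z₁ ∈ D, ∀ K compact, ∃ V ∈ 𝓝 z₁, ∃ M, ∀ z ∈ V, ∀ g ∈ K, ‖Ec z g‖ ≤ M`) and satisfy the cusp letter at threshold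
`T` locally uniformly (`hcusp : ∀ z₁ ∈ D, ∃ V ∈ 𝓝 z₁, ∃ M, ∀ z ∈ V, ∀ g, T < H g → ‖Ec z g − (Ec z)_B g‖ ≤ M`), then **`∀ z₀ ∈ D, ∃ V ∈ 𝓝 z₀, V ⊆ D ∧ ∃ M, ∀ z ∈ V, ∀ g,
‖Λ^T(Ec z)(g)‖ ≤ M`** — §1's compact `C`, `hEbd z₀ C`, `hcusp z₀`, on `V := V_bd ∩ V_cusp ∩ D`. [cite: MoeglinWaldspurger1995, I.2.13 and IV.2] [cite: Arthur1980TraceFormulaII, §1 (Lemma 1.4) and §4] -/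
theorem exists_nhds_forall_norm_truncation_le_of_letters_three (h2 : Module.finrank F E = 2) (hc : c * c = 1) (hc1 : c ≠ 1)
    (hIw : ∀ g : (quasiSplit F E c 3).Adelic, ∃ b ∈ borelAdelic F E c 3, ∃ k : (quasiSplit F E c 3).Adelic,
      adelicVal F E c 3 ((StdForm.antidiagonal 3).over E) k ∈ standardMaximalCompactGL 3 E ∧ g = b * k)
    (ν : Measure (adelicUnipotent F E c 3)) [ν.IsHaarMeasure] {𝓕 : Set (adelicUnipotent F E c 3)}
    (h𝓕 : IsFundamentalDomain (rationalUnipotent F E c 3) 𝓕 ν) {T : ℝ≥0} (hT : 1 ≤ T)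
    (Ec : ℂ → (quasiSplit F E c 3).Adelic → ℂ) {D : Set ℂ} (hDo : IsOpen D)
    (hEcinv : ∀ z ∈ D, ∀ (γ : (quasiSplit F E c 3).arithmeticSubgroup) (x : (quasiSplit F E c 3).Adelic), Ec z ((γ : (quasiSplit F E c 3).Adelic) * x) = Ec z x)
    (hEbd : ∀ z₁ ∈ D, ∀ K : Set (quasiSplit F E c 3).Adelic, IsCompact K → ∃ V ∈ 𝓝 z₁, ∃ M : ℝ, ∀ z ∈ V, ∀ g ∈ K, ‖Ec z g‖ ≤ M)
    (hcusp : ∀ z₁ ∈ D, ∃ V ∈ 𝓝 z₁, ∃ M : ℝ, ∀ z ∈ V, ∀ g : (quasiSplit F E c 3).Adelic, T < borelHeight g → ‖Ec z g - borelConstantTerm ν 𝓕 (Ec z) g‖ ≤ M)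
    {z₀ : ℂ} (hz₀ : z₀ ∈ D) :
    ∃ V ∈ 𝓝 z₀, V ⊆ D ∧ ∃ M : ℝ, ∀ z ∈ V, ∀ g : (quasiSplit F E c 3).Adelic, ‖truncation ν 𝓕 T (Ec z) g‖ ≤ M := by
  obtain ⟨C, hC, hctl⟩ := exists_isCompact_forall_norm_truncation_le_three h2 hc hc1 hIw ν h𝓕 hT
  obtain ⟨V₁, hV₁, M₀, hM₀⟩ := hEbd z₀ hz₀ C hC
  obtain ⟨V₂, hV₂, M₁, hM₁⟩ := hcusp z₀ hz₀
  refine ⟨V₁ ∩ V₂ ∩ D, inter_mem (inter_mem hV₁ hV₂) (hDo.mem_nhds hz₀), inter_subset_right, max M₀ M₁, fun z hz g => ?_⟩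
  exact hctl (hEcinv z hz.2) (fun g hg => hM₀ z hz.1.1 g hg) (hM₁ z hz.1.2) g

variable [MeasurableSpace (quasiSplit F E c 3).Adelic] [BorelSpace (quasiSplit F E c 3).Adelic]

/-- **BOREL DESCENT OF ONE SLICE**: for `T ≥ 1`, `ν` s-finite, `𝓕` a fundamental domain of `N(F)` for a Haar `ν`, and a CONTINUOUS left-`G(F)`-invariant `u`, the truncation `Λ^T u` is Borel
on `G(𝔸)` (★ `measurable_truncation_three`) and left-`G(F)`-invariant (★ `truncation_rational_mul`), so `quotFun (Λ^T u)` is Borel on `X = G(F)∖G(𝔸)` (★ `measurable_quotFun_of_measurable`).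
[cite: MoeglinWaldspurger1995, I.2.13] [cite: Arthur1980TraceFormulaII, §1] -/
theorem measurable_quotFun_truncation_of_continuous_three
    (ν : Measure (adelicUnipotent F E c 3)) [ν.IsHaarMeasure] [SFinite ν] {𝓕 : Set (adelicUnipotent F E c 3)}
    (h𝓕 : IsFundamentalDomain (rationalUnipotent F E c 3) 𝓕 ν) {T : ℝ≥0} (hT : 1 ≤ T) {u : (quasiSplit F E c 3).Adelic → ℂ} (huc : Continuous u)
    (hu : ∀ (γ : (quasiSplit F E c 3).arithmeticSubgroup) (x : (quasiSplit F E c 3).Adelic), u ((γ : (quasiSplit F E c 3).Adelic) * x) = u x) :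
    Measurable ((quasiSplit F E c 3).quotFun (truncation ν 𝓕 T u)) :=
  measurable_quotFun_of_measurable (measurable_truncation_three ν 𝓕 hT huc.measurable) (truncation_rational_mul ν h𝓕 T hu)

end Generic

/-! ## §3 The CM pair `L ∕ L⁺`, `N = 3`: the continued χ-Eisenstein family, HYPOTHESIS-FIRST on (D1) -/

section CM

variable (L : Type) [Field L] [NumberField L] [IsCMField L]
variable [MeasurableSpace (quasiSplit (↥(maximalRealSubfield L)) L (IsCMField.complexConj L) 3).Adelic] [BorelSpace (quasiSplit (↥(maximalRealSubfield L)) L (IsCMField.complexConj L) 3).Adelic]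

/-- **(D2) THE BOUND — `Λ^T Ẽ_χ(z)` IS BOUNDED ON `U(2,1)(𝔸_{L⁺})` LOCALLY UNIFORMLY IN `z ∈ D`, MODULO (D1).**  `ν` Haar on the Heisenberg radical `N(𝔸)`, `𝓕` a fundamental domain of
`N(L⁺)`; `D` OPEN (consumers: the slit plane `{1<Re} ∖ Sp`, or `U ∖ P`); the continued family `Ec` with left-`G(F)`-invariance `hEcinv` and the joint local bound (E2-bd) `hEbd` on `D` (★
exports `…_with_bound` ∕ ★ p863205, the ★ (V)-assembly's binder bytes); the cusp bound (D1) `hD1` at threshold `cstar` locally uniformly on `D`; `1 ≤ T`, `cstar ≤ T`.  THEN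
**`∀ z₀ ∈ D, ∃ V ∈ 𝓝 z₀, V ⊆ D ∧ ∃ M, ∀ z ∈ V, ∀ g, ‖Λ^T(Ec z)(g)‖ ≤ M`** (§2 with `[L:L⁺] = 2`, `c² = 1 ≠ c`, Iwasawa ★ `exists_mem_borelAdelic_mul_mem_standardMaximalCompactGL_cm_three`;
`T < H g ⇒ cstar < H g`). [cite: MoeglinWaldspurger1995, I.2.13 and IV.2] [cite: Arthur1980TraceFormulaII, §1 (Lemma 1.4) and §4] [cite: BernsteinLapid2019, §4] -/
theorem exists_nhds_norm_truncation_continued_le_cm_three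
    (ν : Measure ↥(adelicUnipotent (↥(maximalRealSubfield L)) L (IsCMField.complexConj L) 3)) [ν.IsHaarMeasure]
    {𝓕 : Set ↥(adelicUnipotent (↥(maximalRealSubfield L)) L (IsCMField.complexConj L) 3)}
    (h𝓕N : IsFundamentalDomain ↥(rationalUnipotent (↥(maximalRealSubfield L)) L (IsCMField.complexConj L) 3) 𝓕 ν)
    (Ec : ℂ → (quasiSplit (↥(maximalRealSubfield L)) L (IsCMField.complexConj L) 3).Adelic → ℂ) {D : Set ℂ} (hDo : IsOpen D)
    (hEcinv : ∀ z ∈ D, ∀ (γ : (quasiSplit (↥(maximalRealSubfield L)) L (IsCMField.complexConj L) 3).arithmeticSubgroup) (x : (quasiSplit (↥(maximalRealSubfield L)) L (IsCMField.complexConj L) 3).Adelic),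
      Ec z ((γ : (quasiSplit (↥(maximalRealSubfield L)) L (IsCMField.complexConj L) 3).Adelic) * x) = Ec z x)
    (hEbd : ∀ z₁ ∈ D, ∀ K : Set (quasiSplit (↥(maximalRealSubfield L)) L (IsCMField.complexConj L) 3).Adelic, IsCompact K → ∃ V ∈ 𝓝 z₁, ∃ M : ℝ, ∀ z ∈ V, ∀ g ∈ K, ‖Ec z g‖ ≤ M)
    (cstar : ℝ≥0)
    (hD1 : ∀ z₁ ∈ D, ∃ V ∈ 𝓝 z₁, ∃ M : ℝ, ∀ z ∈ V, ∀ g : (quasiSplit (↥(maximalRealSubfield L)) L (IsCMField.complexConj L) 3).Adelic,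
      cstar < borelHeight g → ‖Ec z g - borelConstantTerm ν 𝓕 (Ec z) g‖ ≤ M)
    {T : ℝ≥0} (hT : 1 ≤ T) (hTc : cstar ≤ T) {z₀ : ℂ} (hz₀ : z₀ ∈ D) :
    ∃ V ∈ 𝓝 z₀, V ⊆ D ∧ ∃ M : ℝ, ∀ z ∈ V, ∀ g : (quasiSplit (↥(maximalRealSubfield L)) L (IsCMField.complexConj L) 3).Adelic, ‖truncation ν 𝓕 T (Ec z) g‖ ≤ M :=
  exists_nhds_forall_norm_truncation_le_of_letters_three (Algebra.IsQuadraticExtension.finrank_eq_two (↥(maximalRealSubfield L)) L)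
    (AlgEquiv.ext fun x => IsCMField.complexConj_apply_apply L x) (IsCMField.complexConj_ne_one L) (exists_mem_borelAdelic_mul_mem_standardMaximalCompactGL_cm_three L)
    ν h𝓕N hT Ec hDo hEcinv hEbd
    (fun z₁ hz₁ => by
      obtain ⟨V, hV, M, hM⟩ := hD1 z₁ hz₁
      exact ⟨V, hV, M, fun z hz g hg => hM z hz g (hTc.trans_lt hg)⟩)
    hz₀

/-- **`quotFun (Λ^T Ẽ_χ(z))` IS BOREL ON `X` for `z ∈ D`** (CM pair, `N = 3`; `ν` Haar on `N(𝔸)` — s-finite since `N(𝔸_{L⁺})` is second countable locally compact — `𝓕` a fundamental domain,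
`1 ≤ T`; separate continuity (E4) `hE4` and invariance `hEcinv`): §2 `measurable_quotFun_truncation_of_continuous_three`. [cite: MoeglinWaldspurger1995, I.2.13] -/
theorem measurable_quotFun_truncation_continued_cm_three
    (ν : Measure ↥(adelicUnipotent (↥(maximalRealSubfield L)) L (IsCMField.complexConj L) 3)) [ν.IsHaarMeasure]
    {𝓕 : Set ↥(adelicUnipotent (↥(maximalRealSubfield L)) L (IsCMField.complexConj L) 3)}
    (h𝓕N : IsFundamentalDomain ↥(rationalUnipotent (↥(maximalRealSubfield L)) L (IsCMField.complexConj L) 3) 𝓕 ν)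
    (Ec : ℂ → (quasiSplit (↥(maximalRealSubfield L)) L (IsCMField.complexConj L) 3).Adelic → ℂ) {D : Set ℂ}
    (hE4 : ∀ z ∈ D, Continuous (Ec z))
    (hEcinv : ∀ z ∈ D, ∀ (γ : (quasiSplit (↥(maximalRealSubfield L)) L (IsCMField.complexConj L) 3).arithmeticSubgroup) (x : (quasiSplit (↥(maximalRealSubfield L)) L (IsCMField.complexConj L) 3).Adelic),
      Ec z ((γ : (quasiSplit (↥(maximalRealSubfield L)) L (IsCMField.complexConj L) 3).Adelic) * x) = Ec z x)
    {T : ℝ≥0} (hT : 1 ≤ T) {z : ℂ} (hz : z ∈ D) :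
    Measurable ((quasiSplit (↥(maximalRealSubfield L)) L (IsCMField.complexConj L) 3).quotFun (truncation ν 𝓕 T (Ec z))) := by
  haveI := secondCountableTopology_adeleRing L
  haveI := locallyCompactSpace_adeleRing' L
  haveI := t2Space_adeleRing_of_numberField L
  haveI : SecondCountableTopology (quasiSplit (↥(maximalRealSubfield L)) L (IsCMField.complexConj L) 3).Adelic :=
    inferInstanceAs (SecondCountableTopology (adelic (↥(maximalRealSubfield L)) L (IsCMField.complexConj L) 3 ((StdForm.antidiagonal 3).over L)))
  haveI : LocallyCompactSpace (quasiSplit (↥(maximalRealSubfield L)) L (IsCMField.complexConj L) 3).Adelic :=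
    inferInstanceAs (LocallyCompactSpace (adelic (↥(maximalRealSubfield L)) L (IsCMField.complexConj L) 3 ((StdForm.antidiagonal 3).over L)))
  haveI : SecondCountableTopology ↥(adelicUnipotent (↥(maximalRealSubfield L)) L (IsCMField.complexConj L) 3) := TopologicalSpace.Subtype.secondCountableTopology _
  have hNcl : IsClosed ((adelicUnipotent (↥(maximalRealSubfield L)) L (IsCMField.complexConj L) 3 :
      Set (quasiSplit (↥(maximalRealSubfield L)) L (IsCMField.complexConj L) 3).Adelic)) := by
    change IsClosed (⇑(adelicVal (↥(maximalRealSubfield L)) L (IsCMField.complexConj L) 3 ((StdForm.antidiagonal 3).over L)) ⁻¹'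
      ((upperUnitriangular (Fin 3) (AdeleRing (𝓞 L) L) : Subgroup (GL (Fin 3) (AdeleRing (𝓞 L) L))) : Set (GL (Fin 3) (AdeleRing (𝓞 L) L))))
    exact (isClosed_upperUnitriangular (R := AdeleRing (𝓞 L) L)).preimage continuous_subtype_val
  haveI : LocallyCompactSpace ↥(adelicUnipotent (↥(maximalRealSubfield L)) L (IsCMField.complexConj L) 3) := hNcl.locallyCompactSpace
  exact measurable_quotFun_truncation_of_continuous_three ν h𝓕N hT (hE4 z hz) (hEcinv z hz)

/-- **(D2) `Λ^T Ẽ_χ(z) ∈ L^p(X, μ)` for `z ∈ D`, EVERY `p`, EVERY FINITE `μ`, MODULO (D1)** — in particular the (D4) assembly's `Fam z := (memLp … 2 μ).toLp` is available: ★ R6e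
`memLp_quotFun_of_bound` with THE BOUND at `z₀ := z` and the Borel descent. [cite: MoeglinWaldspurger1995, I.2.13 and IV.2] [cite: BernsteinLapid2019, §4] -/
theorem memLp_quotFun_truncation_continued_cm_three
    (ν : Measure ↥(adelicUnipotent (↥(maximalRealSubfield L)) L (IsCMField.complexConj L) 3)) [ν.IsHaarMeasure]
    {𝓕 : Set ↥(adelicUnipotent (↥(maximalRealSubfield L)) L (IsCMField.complexConj L) 3)}
    (h𝓕N : IsFundamentalDomain ↥(rationalUnipotent (↥(maximalRealSubfield L)) L (IsCMField.complexConj L) 3) 𝓕 ν)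
    (Ec : ℂ → (quasiSplit (↥(maximalRealSubfield L)) L (IsCMField.complexConj L) 3).Adelic → ℂ) {D : Set ℂ} (hDo : IsOpen D)
    (hE4 : ∀ z ∈ D, Continuous (Ec z))
    (hEbd : ∀ z₁ ∈ D, ∀ K : Set (quasiSplit (↥(maximalRealSubfield L)) L (IsCMField.complexConj L) 3).Adelic, IsCompact K → ∃ V ∈ 𝓝 z₁, ∃ M : ℝ, ∀ z ∈ V, ∀ g ∈ K, ‖Ec z g‖ ≤ M)
    (hEcinv : ∀ z ∈ D, ∀ (γ : (quasiSplit (↥(maximalRealSubfield L)) L (IsCMField.complexConj L) 3).arithmeticSubgroup) (x : (quasiSplit (↥(maximalRealSubfield L)) L (IsCMField.complexConj L) 3).Adelic),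
      Ec z ((γ : (quasiSplit (↥(maximalRealSubfield L)) L (IsCMField.complexConj L) 3).Adelic) * x) = Ec z x)
    (cstar : ℝ≥0)
    (hD1 : ∀ z₁ ∈ D, ∃ V ∈ 𝓝 z₁, ∃ M : ℝ, ∀ z ∈ V, ∀ g : (quasiSplit (↥(maximalRealSubfield L)) L (IsCMField.complexConj L) 3).Adelic,
      cstar < borelHeight g → ‖Ec z g - borelConstantTerm ν 𝓕 (Ec z) g‖ ≤ M)
    {T : ℝ≥0} (hT : 1 ≤ T) (hTc : cstar ≤ T)
    (μ : Measure (quasiSplit (↥(maximalRealSubfield L)) L (IsCMField.complexConj L) 3).automorphicQuotient) [IsFiniteMeasure μ] (p : ℝ≥0∞) {z : ℂ} (hz : z ∈ D) :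
    MemLp ((quasiSplit (↥(maximalRealSubfield L)) L (IsCMField.complexConj L) 3).quotFun (truncation ν 𝓕 T (Ec z))) p μ := by
  obtain ⟨V, hV, -, M, hM⟩ := exists_nhds_norm_truncation_continued_le_cm_three L ν h𝓕N Ec hDo hEcinv hEbd cstar hD1 hT hTc hz
  exact memLp_quotFun_of_bound _ μ p (hM z (mem_of_mem_nhds hV))
    (measurable_quotFun_truncation_continued_cm_three L ν h𝓕N Ec hE4 hEcinv hT hz).aestronglyMeasurable

/-- **THE `hloc` INPUT OF ★ `Literature.Analysis.Complex.analyticOnNhd_of_locally_bounded`, TOKEN FOR TOKEN** (`U := D`, `f s := quotFun (Λ^T_{ν,𝓕}(Ec s))`), MODULO (D1):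
`∀ s₀ ∈ D, ∃ V ∈ 𝓝 s₀, ∃ C, ∀ s ∈ V, ∀ x, ‖quotFun (Λ^T(Ec s)) x‖ ≤ C` — THE BOUND read on the quotient (★ `norm_quotFun_le`). [cite: MoeglinWaldspurger1995, IV.2] [cite: BernsteinLapid2019, §4] -/
theorem hloc_truncation_continued_cm_three
    (ν : Measure ↥(adelicUnipotent (↥(maximalRealSubfield L)) L (IsCMField.complexConj L) 3)) [ν.IsHaarMeasure]
    {𝓕 : Set ↥(adelicUnipotent (↥(maximalRealSubfield L)) L (IsCMField.complexConj L) 3)}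
    (h𝓕N : IsFundamentalDomain ↥(rationalUnipotent (↥(maximalRealSubfield L)) L (IsCMField.complexConj L) 3) 𝓕 ν)
    (Ec : ℂ → (quasiSplit (↥(maximalRealSubfield L)) L (IsCMField.complexConj L) 3).Adelic → ℂ) {D : Set ℂ} (hDo : IsOpen D)
    (hEcinv : ∀ z ∈ D, ∀ (γ : (quasiSplit (↥(maximalRealSubfield L)) L (IsCMField.complexConj L) 3).arithmeticSubgroup) (x : (quasiSplit (↥(maximalRealSubfield L)) L (IsCMField.complexConj L) 3).Adelic),
      Ec z ((γ : (quasiSplit (↥(maximalRealSubfield L)) L (IsCMField.complexConj L) 3).Adelic) * x) = Ec z x)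
    (hEbd : ∀ z₁ ∈ D, ∀ K : Set (quasiSplit (↥(maximalRealSubfield L)) L (IsCMField.complexConj L) 3).Adelic, IsCompact K → ∃ V ∈ 𝓝 z₁, ∃ M : ℝ, ∀ z ∈ V, ∀ g ∈ K, ‖Ec z g‖ ≤ M)
    (cstar : ℝ≥0)
    (hD1 : ∀ z₁ ∈ D, ∃ V ∈ 𝓝 z₁, ∃ M : ℝ, ∀ z ∈ V, ∀ g : (quasiSplit (↥(maximalRealSubfield L)) L (IsCMField.complexConj L) 3).Adelic,
      cstar < borelHeight g → ‖Ec z g - borelConstantTerm ν 𝓕 (Ec z) g‖ ≤ M)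
    {T : ℝ≥0} (hT : 1 ≤ T) (hTc : cstar ≤ T) :
    ∀ s₀ ∈ D, ∃ V ∈ 𝓝 s₀, ∃ C : ℝ, ∀ s ∈ V, ∀ x : (quasiSplit (↥(maximalRealSubfield L)) L (IsCMField.complexConj L) 3).automorphicQuotient,
      ‖(quasiSplit (↥(maximalRealSubfield L)) L (IsCMField.complexConj L) 3).quotFun (truncation ν 𝓕 T (Ec s)) x‖ ≤ C := by
  intro s₀ hs₀
  obtain ⟨V, hV, -, M, hM⟩ := exists_nhds_norm_truncation_continued_le_cm_three L ν h𝓕N Ec hDo hEcinv hEbd cstar hD1 hT hTc hs₀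
  exact ⟨V, hV, M, fun s hs x => AdelicGroupData.norm_quotFun_le (hM s hs) x⟩

/-- **THE `hmeas` INPUT OF ★ `Literature.Analysis.Complex.analyticOnNhd_of_locally_bounded`, TOKEN FOR TOKEN** (`U := D`, `f s := quotFun (Λ^T_{ν,𝓕}(Ec s))`):
`∀ s ∈ D, AEStronglyMeasurable (quotFun (Λ^T(Ec s))) μ` (Borel descent of each slice, (E4) + `hEcinv`). [cite: MoeglinWaldspurger1995, I.2.13] -/
theorem hmeas_truncation_continued_cm_three
    (ν : Measure ↥(adelicUnipotent (↥(maximalRealSubfield L)) L (IsCMField.complexConj L) 3)) [ν.IsHaarMeasure]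
    {𝓕 : Set ↥(adelicUnipotent (↥(maximalRealSubfield L)) L (IsCMField.complexConj L) 3)}
    (h𝓕N : IsFundamentalDomain ↥(rationalUnipotent (↥(maximalRealSubfield L)) L (IsCMField.complexConj L) 3) 𝓕 ν)
    (Ec : ℂ → (quasiSplit (↥(maximalRealSubfield L)) L (IsCMField.complexConj L) 3).Adelic → ℂ) {D : Set ℂ}
    (hE4 : ∀ z ∈ D, Continuous (Ec z))
    (hEcinv : ∀ z ∈ D, ∀ (γ : (quasiSplit (↥(maximalRealSubfield L)) L (IsCMField.complexConj L) 3).arithmeticSubgroup) (x : (quasiSplit (↥(maximalRealSubfield L)) L (IsCMField.complexConj L) 3).Adelic),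
      Ec z ((γ : (quasiSplit (↥(maximalRealSubfield L)) L (IsCMField.complexConj L) 3).Adelic) * x) = Ec z x)
    {T : ℝ≥0} (hT : 1 ≤ T)
    (μ : Measure (quasiSplit (↥(maximalRealSubfield L)) L (IsCMField.complexConj L) 3).automorphicQuotient) :
    ∀ s ∈ D, AEStronglyMeasurable ((quasiSplit (↥(maximalRealSubfield L)) L (IsCMField.complexConj L) 3).quotFun (truncation ν 𝓕 T (Ec s))) μ :=
  fun _ hs => (measurable_quotFun_truncation_continued_cm_three L ν h𝓕N Ec hE4 hEcinv hT hs).aestronglyMeasurable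

end CM

/-! ## §4 The hCONT ∕ (V) FRAME: the slit plane `{1<Re} ∖ Sp`, letters `hE4 hEbd hEcinv` (★ (V)-assembly) and `(cstar) (hD1)` ((D1)) in their bytes VERBATIM -/

section Slit

variable (L : Type) [Field L] [NumberField L] [IsCMField L]
variable [MeasurableSpace (quasiSplit (↥(maximalRealSubfield L)) L (IsCMField.complexConj L) 3).Adelic] [BorelSpace (quasiSplit (↥(maximalRealSubfield L)) L (IsCMField.complexConj L) 3).Adelic]

/-- The slit plane `{1<Re} ∖ Sp` (`Sp` a finite pole ledger) is open. [cite: MoeglinWaldspurger1995, IV.1.11] -/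
theorem isOpen_slitPlane (Sp : Finset ℂ) : IsOpen ({z : ℂ | 1 < z.re} \ (↑Sp : Set ℂ)) :=
  (isOpen_lt continuous_const Complex.continuous_re).sdiff Sp.finite_toSet.isClosed

/-- **(D2) ON THE SLIT PLANE — THE BOUND, MODULO (D1)**: with `hEbd hEcinv` in the ★ (V)-assembly's bytes on `{1<Re} ∖ Sp` and `(cstar) (hD1)` in (D1)'s bytes (K2E1-p10, R90 bus
2026-09-05T00:42:58Z), for `1 ≤ T`, `cstar ≤ T`: `∀ z₀ ∈ {1<Re} ∖ Sp, ∃ V ∈ 𝓝 z₀, V ⊆ {1<Re} ∖ Sp ∧ ∃ M, ∀ z ∈ V, ∀ g, ‖Λ^T(Ec z)(g)‖ ≤ M` (§3 at `D := {1<Re} ∖ Sp`).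
[cite: MoeglinWaldspurger1995, I.2.13 and IV.2] [cite: Arthur1980TraceFormulaII, §1 (Lemma 1.4) and §4] [cite: BernsteinLapid2019, §4] -/
theorem exists_nhds_norm_truncation_continued_le_slit_cm_three
    (ν : Measure ↥(adelicUnipotent (↥(maximalRealSubfield L)) L (IsCMField.complexConj L) 3)) [ν.IsHaarMeasure]
    {𝓕 : Set ↥(adelicUnipotent (↥(maximalRealSubfield L)) L (IsCMField.complexConj L) 3)}
    (h𝓕N : IsFundamentalDomain ↥(rationalUnipotent (↥(maximalRealSubfield L)) L (IsCMField.complexConj L) 3) 𝓕 ν)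
    (Ec : ℂ → (quasiSplit (↥(maximalRealSubfield L)) L (IsCMField.complexConj L) 3).Adelic → ℂ) (Sp : Finset ℂ)
    (hEbd : ∀ z₁ ∈ ({z : ℂ | 1 < z.re} \ (↑Sp : Set ℂ)), ∀ K : Set (quasiSplit (↥(maximalRealSubfield L)) L (IsCMField.complexConj L) 3).Adelic, IsCompact K → ∃ V ∈ 𝓝 z₁, ∃ M : ℝ, ∀ z ∈ V, ∀ g ∈ K, ‖Ec z g‖ ≤ M)
    (hEcinv : ∀ z ∈ ({z : ℂ | 1 < z.re} \ (↑Sp : Set ℂ)), ∀ (γ : (quasiSplit (↥(maximalRealSubfield L)) L (IsCMField.complexConj L) 3).arithmeticSubgroup) (x : (quasiSplit (↥(maximalRealSubfield L)) L (IsCMField.complexConj L) 3).Adelic), Ec z ((γ : (quasiSplit (↥(maximalRealSubfield L)) L (IsCMField.complexConj L) 3).Adelic) * x) = Ec z x)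
    (cstar : ℝ≥0) (hD1 : ∀ z₁ ∈ ({z : ℂ | 1 < z.re} \ (↑Sp : Set ℂ)), ∃ V ∈ 𝓝 z₁, ∃ M : ℝ, ∀ z ∈ V, ∀ g : (quasiSplit (↥(maximalRealSubfield L)) L (IsCMField.complexConj L) 3).Adelic, cstar < borelHeight g → ‖Ec z g - borelConstantTerm ν 𝓕 (Ec z) g‖ ≤ M)
    {T : ℝ≥0} (hT : 1 ≤ T) (hTc : cstar ≤ T) {z₀ : ℂ} (hz₀ : z₀ ∈ ({z : ℂ | 1 < z.re} \ (↑Sp : Set ℂ))) :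
    ∃ V ∈ 𝓝 z₀, V ⊆ ({z : ℂ | 1 < z.re} \ (↑Sp : Set ℂ)) ∧ ∃ M : ℝ, ∀ z ∈ V, ∀ g : (quasiSplit (↥(maximalRealSubfield L)) L (IsCMField.complexConj L) 3).Adelic, ‖truncation ν 𝓕 T (Ec z) g‖ ≤ M :=
  exists_nhds_norm_truncation_continued_le_cm_three L ν h𝓕N Ec (isOpen_slitPlane Sp) hEcinv hEbd cstar hD1 hT hTc hz₀

/-- **(D2) ON THE SLIT PLANE — `Λ^T Ẽ_χ(z) ∈ L^p(X, μ)` for `z ∈ {1<Re} ∖ Sp`, every `p`, every finite `μ` (e.g. an automorphic measure), MODULO (D1)** — (D4)'s `Fam z := (… 2 μ).toLp`.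
[cite: MoeglinWaldspurger1995, I.2.13 and IV.2] [cite: BernsteinLapid2019, §4] -/
theorem memLp_quotFun_truncation_continued_slit_cm_three
    (ν : Measure ↥(adelicUnipotent (↥(maximalRealSubfield L)) L (IsCMField.complexConj L) 3)) [ν.IsHaarMeasure]
    {𝓕 : Set ↥(adelicUnipotent (↥(maximalRealSubfield L)) L (IsCMField.complexConj L) 3)}
    (h𝓕N : IsFundamentalDomain ↥(rationalUnipotent (↥(maximalRealSubfield L)) L (IsCMField.complexConj L) 3) 𝓕 ν)
    (Ec : ℂ → (quasiSplit (↥(maximalRealSubfield L)) L (IsCMField.complexConj L) 3).Adelic → ℂ) (Sp : Finset ℂ)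
    (hE4 : ∀ z ∈ ({z : ℂ | 1 < z.re} \ (↑Sp : Set ℂ)), Continuous (Ec z))
    (hEbd : ∀ z₁ ∈ ({z : ℂ | 1 < z.re} \ (↑Sp : Set ℂ)), ∀ K : Set (quasiSplit (↥(maximalRealSubfield L)) L (IsCMField.complexConj L) 3).Adelic, IsCompact K → ∃ V ∈ 𝓝 z₁, ∃ M : ℝ, ∀ z ∈ V, ∀ g ∈ K, ‖Ec z g‖ ≤ M)
    (hEcinv : ∀ z ∈ ({z : ℂ | 1 < z.re} \ (↑Sp : Set ℂ)), ∀ (γ : (quasiSplit (↥(maximalRealSubfield L)) L (IsCMField.complexConj L) 3).arithmeticSubgroup) (x : (quasiSplit (↥(maximalRealSubfield L)) L (IsCMField.complexConj L) 3).Adelic), Ec z ((γ : (quasiSplit (↥(maximalRealSubfield L)) L (IsCMField.complexConj L) 3).Adelic) * x) = Ec z x)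
    (cstar : ℝ≥0) (hD1 : ∀ z₁ ∈ ({z : ℂ | 1 < z.re} \ (↑Sp : Set ℂ)), ∃ V ∈ 𝓝 z₁, ∃ M : ℝ, ∀ z ∈ V, ∀ g : (quasiSplit (↥(maximalRealSubfield L)) L (IsCMField.complexConj L) 3).Adelic, cstar < borelHeight g → ‖Ec z g - borelConstantTerm ν 𝓕 (Ec z) g‖ ≤ M)
    {T : ℝ≥0} (hT : 1 ≤ T) (hTc : cstar ≤ T)
    (μ : Measure (quasiSplit (↥(maximalRealSubfield L)) L (IsCMField.complexConj L) 3).automorphicQuotient) [IsFiniteMeasure μ] (p : ℝ≥0∞)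
    {z : ℂ} (hz : z ∈ ({z : ℂ | 1 < z.re} \ (↑Sp : Set ℂ))) :
    MemLp ((quasiSplit (↥(maximalRealSubfield L)) L (IsCMField.complexConj L) 3).quotFun (truncation ν 𝓕 T (Ec z))) p μ :=
  memLp_quotFun_truncation_continued_cm_three L ν h𝓕N Ec (isOpen_slitPlane Sp) hE4 hEbd hEcinv cstar hD1 hT hTc μ p hz

/-- **(D2) ON THE SLIT PLANE — the `hloc` input of ★ `analyticOnNhd_of_locally_bounded`** (`U := {1<Re} ∖ Sp`, `f s := quotFun (Λ^T_{ν,𝓕}(Ec s))`), MODULO (D1).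
[cite: MoeglinWaldspurger1995, IV.2] [cite: BernsteinLapid2019, §4] -/
theorem hloc_truncation_continued_slit_cm_three
    (ν : Measure ↥(adelicUnipotent (↥(maximalRealSubfield L)) L (IsCMField.complexConj L) 3)) [ν.IsHaarMeasure]
    {𝓕 : Set ↥(adelicUnipotent (↥(maximalRealSubfield L)) L (IsCMField.complexConj L) 3)}
    (h𝓕N : IsFundamentalDomain ↥(rationalUnipotent (↥(maximalRealSubfield L)) L (IsCMField.complexConj L) 3) 𝓕 ν)
    (Ec : ℂ → (quasiSplit (↥(maximalRealSubfield L)) L (IsCMField.complexConj L) 3).Adelic → ℂ) (Sp : Finset ℂ)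
    (hEbd : ∀ z₁ ∈ ({z : ℂ | 1 < z.re} \ (↑Sp : Set ℂ)), ∀ K : Set (quasiSplit (↥(maximalRealSubfield L)) L (IsCMField.complexConj L) 3).Adelic, IsCompact K → ∃ V ∈ 𝓝 z₁, ∃ M : ℝ, ∀ z ∈ V, ∀ g ∈ K, ‖Ec z g‖ ≤ M)
    (hEcinv : ∀ z ∈ ({z : ℂ | 1 < z.re} \ (↑Sp : Set ℂ)), ∀ (γ : (quasiSplit (↥(maximalRealSubfield L)) L (IsCMField.complexConj L) 3).arithmeticSubgroup) (x : (quasiSplit (↥(maximalRealSubfield L)) L (IsCMField.complexConj L) 3).Adelic), Ec z ((γ : (quasiSplit (↥(maximalRealSubfield L)) L (IsCMField.complexConj L) 3).Adelic) * x) = Ec z x)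
    (cstar : ℝ≥0) (hD1 : ∀ z₁ ∈ ({z : ℂ | 1 < z.re} \ (↑Sp : Set ℂ)), ∃ V ∈ 𝓝 z₁, ∃ M : ℝ, ∀ z ∈ V, ∀ g : (quasiSplit (↥(maximalRealSubfield L)) L (IsCMField.complexConj L) 3).Adelic, cstar < borelHeight g → ‖Ec z g - borelConstantTerm ν 𝓕 (Ec z) g‖ ≤ M)
    {T : ℝ≥0} (hT : 1 ≤ T) (hTc : cstar ≤ T) :
    ∀ s₀ ∈ ({z : ℂ | 1 < z.re} \ (↑Sp : Set ℂ)), ∃ V ∈ 𝓝 s₀, ∃ C : ℝ, ∀ s ∈ V, ∀ x : (quasiSplit (↥(maximalRealSubfield L)) L (IsCMField.complexConj L) 3).automorphicQuotient,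
      ‖(quasiSplit (↥(maximalRealSubfield L)) L (IsCMField.complexConj L) 3).quotFun (truncation ν 𝓕 T (Ec s)) x‖ ≤ C :=
  hloc_truncation_continued_cm_three L ν h𝓕N Ec (isOpen_slitPlane Sp) hEcinv hEbd cstar hD1 hT hTc

/-- **(D2) ON THE SLIT PLANE — the `hmeas` input of ★ `analyticOnNhd_of_locally_bounded`** (`U := {1<Re} ∖ Sp`, `f s := quotFun (Λ^T_{ν,𝓕}(Ec s))`): every slice is a.e.-strongly
measurable for every measure `μ` on `X` ((E4) + `hEcinv`; no (D1) needed). [cite: MoeglinWaldspurger1995, I.2.13] -/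
theorem hmeas_truncation_continued_slit_cm_three
    (ν : Measure ↥(adelicUnipotent (↥(maximalRealSubfield L)) L (IsCMField.complexConj L) 3)) [ν.IsHaarMeasure]
    {𝓕 : Set ↥(adelicUnipotent (↥(maximalRealSubfield L)) L (IsCMField.complexConj L) 3)}
    (h𝓕N : IsFundamentalDomain ↥(rationalUnipotent (↥(maximalRealSubfield L)) L (IsCMField.complexConj L) 3) 𝓕 ν)
    (Ec : ℂ → (quasiSplit (↥(maximalRealSubfield L)) L (IsCMField.complexConj L) 3).Adelic → ℂ) (Sp : Finset ℂ)
    (hE4 : ∀ z ∈ ({z : ℂ | 1 < z.re} \ (↑Sp : Set ℂ)), Continuous (Ec z))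
    (hEcinv : ∀ z ∈ ({z : ℂ | 1 < z.re} \ (↑Sp : Set ℂ)), ∀ (γ : (quasiSplit (↥(maximalRealSubfield L)) L (IsCMField.complexConj L) 3).arithmeticSubgroup) (x : (quasiSplit (↥(maximalRealSubfield L)) L (IsCMField.complexConj L) 3).Adelic), Ec z ((γ : (quasiSplit (↥(maximalRealSubfield L)) L (IsCMField.complexConj L) 3).Adelic) * x) = Ec z x)
    {T : ℝ≥0} (hT : 1 ≤ T)
    (μ : Measure (quasiSplit (↥(maximalRealSubfield L)) L (IsCMField.complexConj L) 3).automorphicQuotient) :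
    ∀ s ∈ ({z : ℂ | 1 < z.re} \ (↑Sp : Set ℂ)), AEStronglyMeasurable ((quasiSplit (↥(maximalRealSubfield L)) L (IsCMField.complexConj L) 3).quotFun (truncation ν 𝓕 T (Ec s))) μ :=
  hmeas_truncation_continued_cm_three L ν h𝓕N Ec hE4 hEcinv hT μ

end Slit

end Summit.HodgeConjecture.HodgeConjecture.Cruxes.H413.K2E1ChiContinuedTruncationBoundedCMThree

end
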